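import Summits.CriticalPhenomena.CardyFormulaZ2.Theorems.CardyIKTransportIKMixedBoxCrossingDefectStubGadget

/-!
# Stub `stub_pivotSolve` of the line `defect-closure-exploration` (crux `IKMixedBoxCrossing`,
# stmt-CriticalPhenomena-5911): solving the face-parity system at the NE pivots

For a finite set `D` of faces (in the stub: a defect set `D ⊆ innerVertices Λ`) and any colouring `τ`, there
is exactly one colouring `σ` that agrees with `τ` off the pivot set `P = D.image (· + 1)` (the NE cells of
the faces of `D`) and has no odd face in `D`.

PROOF (programme (R) helper; elementary, no literature fact).  The parity constraints of the faces of `D`,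
each solved at its NE cell, form a unitriangular system over `𝔽₂`.  Induction on `D` removing the face `a`
maximising `v 0 + v 1` (`Finset.induction_on_max_value`, as in the RANK LEMMA of the Gadget stub file):
* the NE cell `a + 1` of `a` lies in no other face of `D` (`add_one_not_mem_cellFace`), so resetting the
  colour of `a + 1` changes the parity of no face of `D.erase a` (`isOddFace_congr`), while the parity of
  `a` itself is the XOR of its three other cells and of the colour at `a + 1` (`isOddFace_iff_xor`);
* existence: solve `D.erase a` first (induction hypothesis, solution `σ₀`), then set the pivot `a + 1` to
  the unique Boolean making `a` even;
* uniqueness: for a second solution `σ'`, resetting its pivot `a + 1` to `τ (a + 1)` gives a solution for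
  `D.erase a`, hence `σ₀` by the induction hypothesis; so `σ'` and `σ` agree off `a + 1`, and at `a + 1` by
  the parity of the face `a`.
-/

namespace Summit.CriticalPhenomena.CardyFormulaZ2.Cruxes.IKMixedBoxCrossing.DefectClosureExploration

open Literature.Probability.LatticeModels

namespace PivotSolveStub

/-- Parity of the face `w` after resetting its NE cell `w + 1` to `b`: the XOR of the three other cells of
the face and of `b`. -/
theorem isOddFace_update_add_one (σ : Site 2 → Bool) (w : Site 2) (b : Bool) :
    IsOddFace (Function.update σ (w + 1) b) w ↔
      (((σ w ^^ σ (w + Pi.single 0 1)) ^^ (σ (w + Pi.single 1 1) ^^ b)) = true) := by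
  obtain ⟨h0, h1, h2⟩ := ne_add_one_cells w
  rw [isOddFace_iff_xor, Function.update_of_ne h0, Function.update_of_ne h1, Function.update_of_ne h2,
    Function.update_self]

/-- The face `w` of `Function.update σ (w + 1) b` is even iff `b` is the XOR of the three other cells: the
pivot equation of the face `w` has exactly one solution. -/
theorem not_isOddFace_update_add_one_iff (σ : Site 2 → Bool) (w : Site 2) (b : Bool) :
    ¬ IsOddFace (Function.update σ (w + 1) b) w ↔
      b = ((σ w ^^ σ (w + Pi.single 0 1)) ^^ σ (w + Pi.single 1 1)) := by
  rw [isOddFace_update_add_one]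
  cases σ w <;> cases σ (w + Pi.single 0 1) <;> cases σ (w + Pi.single 1 1) <;> cases b <;> decide

/-- Off the pivot set of `insert a s`: `x` is not a pivot iff `x ≠ a + 1` and `x` is not a pivot of `s`. -/
theorem not_mem_image_insert_add_one {a x : Site 2} {s : Finset (Site 2)} :
    x ∉ (insert a s).image (· + 1) ↔ x ≠ a + 1 ∧ x ∉ s.image (· + 1) := by
  rw [Finset.image_insert, Finset.mem_insert, not_or]

/-- **Pivot solve** for an arbitrary finite face set `D`: for every colouring `τ` there is exactly one
colouring agreeing with `τ` off the NE pivots `D.image (· + 1)` and having no odd face in `D`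
(the face-parity system is unitriangular when each face is solved at its NE cell, faces ordered by
`v 0 + v 1`). -/
theorem pivotSolve (D : Finset (Site 2)) :
    ∀ τ : Site 2 → Bool, ∃! σ : Site 2 → Bool,
      (∀ x : Site 2, x ∉ D.image (· + 1) → σ x = τ x) ∧ ∀ g ∈ D, ¬ IsOddFace σ g := by
  induction D using Finset.induction_on_max_value (fun v : Site 2 => v 0 + v 1) with
  | empty =>
    intro τ
    refine ⟨τ, ⟨fun x _ => rfl, fun g hg => absurd hg (Finset.notMem_empty g)⟩, ?_⟩
    rintro σ ⟨hσ, -⟩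
    exact funext fun x => hσ x (by simp)
  | insert a s ha hmax ih =>
    intro τ
    obtain ⟨σ₀, ⟨hτ₀, heven₀⟩, huniq₀⟩ := ih τ
    -- the NE cell `a + 1` of the maximal face `a` lies in no face of `s`
    have hcell : ∀ g ∈ s, a + 1 ∉ cellFace g := fun g hg =>
      add_one_not_mem_cellFace (hmax g hg) fun h => ha (h ▸ hg)
    -- so resetting the colour at `a + 1` does not change the parity of the faces of `s`
    have hcongr : ∀ (σ : Site 2 → Bool) (b : Bool), ∀ g ∈ s,
        (IsOddFace (Function.update σ (a + 1) b) g ↔ IsOddFace σ g) := fun σ b g hg =>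
      isOddFace_congr fun x hx => Function.update_of_ne (fun h : x = a + 1 => hcell g hg (h ▸ hx)) _ _
    -- the unique value of the pivot `a + 1` making the face `a` even
    obtain ⟨b, hb⟩ : ∃ b : Bool, ∀ b' : Bool, ¬ IsOddFace (Function.update σ₀ (a + 1) b') a ↔ b' = b :=
      ⟨_, fun b' => not_isOddFace_update_add_one_iff σ₀ a b'⟩
    refine ⟨Function.update σ₀ (a + 1) b, ⟨fun x hx => ?_, fun g hg => ?_⟩, ?_⟩
    · obtain ⟨hxa, hxs⟩ := not_mem_image_insert_add_one.1 hx
      rw [Function.update_of_ne hxa]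
      exact hτ₀ x hxs
    · rcases Finset.mem_insert.1 hg with rfl | hg
      · exact (hb b).2 rfl
      · rw [hcongr σ₀ b g hg]
        exact heven₀ g hg
    · rintro σ' ⟨hτ', heven'⟩
      -- resetting the pivot `a + 1` of `σ'` to `τ (a + 1)` gives the solution for `s`
      have hreset : Function.update σ' (a + 1) (τ (a + 1)) = σ₀ := by
        refine huniq₀ _ ⟨fun x hx => ?_, fun g hg => ?_⟩
        · rcases eq_or_ne x (a + 1) with rfl | hxa
          · exact Function.update_self _ _ _
          · rw [Function.update_of_ne hxa]
            exact hτ' x (not_mem_image_insert_add_one.2 ⟨hxa, hx⟩)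
        · rw [hcongr σ' _ g hg]
          exact heven' g (Finset.mem_insert_of_mem hg)
      have hoff : ∀ x : Site 2, x ≠ a + 1 → σ' x = σ₀ x := fun x hx => by
        rw [← hreset, Function.update_of_ne hx]
      -- hence `σ'` is `σ₀` with the pivot reset to `σ' (a + 1)`, and the parity of `a` fixes that value
      have hσ' : σ' = Function.update σ₀ (a + 1) (σ' (a + 1)) := by
        funext y
        rcases eq_or_ne y (a + 1) with rfl | hy
        · rw [Function.update_self]
        · rw [Function.update_of_ne hy, hoff y hy]
      have hpiv : σ' (a + 1) = b := by
        have ha' := heven' a (Finset.mem_insert_self a s)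
        rw [hσ'] at ha'
        exact (hb _).1 ha'
      rw [hσ', hpiv]

end PivotSolveStub

/-- **Stub `stub_pivotSolve`** (programme (R) helper: the exact pivot coupling of the IK colour field to a
product measure).  For a defect set `D ⊆ innerVertices Λ` and any colouring `τ`, there is exactly one
colouring `σ` agreeing with `τ` off the pivot set `D.image (· + 1)` (the NE cells of the faces of `D`) with
no odd face in `D`: the face-parity constraints, solved at the NE cells in decreasing order of `v 0 + v 1`,
form a unitriangular system over `𝔽₂` (`PivotSolveStub.pivotSolve`, which does not even need
`D ⊆ innerVertices Λ`). -/
theorem stub_pivotSolve : ∀ (D Λ : Finset (Site 2)), D ⊆ innerVertices Λ → ∀ τ : Site 2 → Bool,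
    ∃! σ : Site 2 → Bool, (∀ x : Site 2, x ∉ D.image (· + 1) → σ x = τ x) ∧ ∀ g ∈ D, ¬ IsOddFace σ g :=
  fun D _ _ τ => PivotSolveStub.pivotSolve D τ

end Summit.CriticalPhenomena.CardyFormulaZ2.Cruxes.IKMixedBoxCrossing.DefectClosureExploration
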